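import Summits.CriticalPhenomena.PercolationContinuityZ3.Theorems.PercNearOneGluingAdditiveGluingKnThm2Good
import Summits.CriticalPhenomena.PercolationContinuityZ3.Theorems.PercNearOneGluingAdditiveGluingBhkSets
import Summits.CriticalPhenomena.PercolationContinuityZ3.Theorems.PercNearOneGluingAdditiveGluingKnLemma2
import HarnessLib

/-! # Crux `PercNearOneGluing.AdditiveGluing` (stmt-CriticalPhenomena-4576): three relays —
# the additive gluing inequality for `|A| = 3` reduced to ONE inequality in Kozma–Nitzan's "bad region"

Support file (`--supports stmt-CriticalPhenomena-4576`, deep seat r2).  No definitions, no named facts; the one open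
inequality is displayed verbatim as the hypothesis `hR` of the final theorems (a CONDITIONAL reduction).

Setting: the complete weighted graph on `Fin n` (`μ = prodBernoulli w`), three distinct relays `a₁, a₂, a₃`, a target
`b` and an observer `o`; `τᵢ = μ(aᵢ ↔ b)`, `a₃` a worst relay (`τ₃ ≤ τ₁, τ₂`);
`N₁₂ = {a₁↮a₃} ∩ {a₂↮a₃}`, `N₁ = {a₁↮a₂} ∩ {a₁↮a₃}`, `N₂ = {a₂↮a₁} ∩ {a₂↮a₃}`, `Pₖ = μ(Nₖ)`,
`A₁₂ = μ(N₁₂ ∩ {a₁↔o ∨ a₂↔o})`, `Aₖ = μ(Nₖ ∩ {aₖ ↔ o})`, `m_T = μ(C(b) ∩ A = T)` written on the `N`'s as in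
`…KnThm2GoodEvents`, and the additive room `D = μ(o ↮ A, a₃ ↮ b)`.

Kozma–Nitzan's Theorem 2 (arXiv:2401.12397, pp. 8–9; landed as `knThm2_core` / `stub_knThm2Good`) proves the pre-FKG
inequality (3) — hence the additive inequality `μ(o↔A ∖ o↔b) ≤ μ(a₃ ↮ b)` — in the GOOD case `m₃ ≤ m₁₂`.  This file
shows that the additive inequality for three relays holds in general as soon as the following "bad-region certificate"
holds whenever `a₃` is worst, `o` is strictly less reliable than `a₃`, and `m₁₂ < m₃`:

  `0 ≤ A₁₂ P₁ P₂ (m₁₂ − m₃) + A₁ P₁₂ P₂ (m₁ − m₂₃) + A₂ P₁₂ P₁ (m₂ − m₁₃) + P₁ P₂ P₁₂ · D`        (T1)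

i.e. KN's six BHK bounds plus the additive room suffice (`knThm2_region_core`, `knThm2_region_eform`), and the
assembly `additiveGluing_threeRelays_of_regionCert`: worst relay `a₃`; `τ(o) ≥ τ₃` is trivial; `m₃ ≤ m₁₂` is KN's
Theorem 2 (`knThm2_core` with the landed `stub_bhkSets`, `stub_knLemma2`); `m₁₂ < m₃` is (T1).
Numerics for (T1) (deep seat r2, exact partition-DP engine; item evidence REGION-LEMMA-d2.md): 0 violations in
≈ 2.9·10⁵ instances with `o` bad (n = 5 exhaustive two-level weights, n ≤ 7 random) and under region-constrained annealing
(infimum of the normalised margin → 0⁺ only at the identity locus `o ≡ a₁`, `τ₁ = τ₃`); WITHOUT `τ(o) < τ₃` it is false.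
[cite: KozmaNitzan2024, Theorem 2 (§3.2, pp. 8–9), Lemma 2 (p. 6); VandenbergHaggstromKahn2005, Thms. 1.3–1.4]
-/

namespace Summit.CriticalPhenomena.PercolationContinuityZ3.Theorems

open MeasureTheory Set Literature.Probability.LatticeModels Literature.Probability.Percolation

noncomputable section
open Classical

variable {n : ℕ}

/-- **Arithmetic of the bad region**: KN's six BHK bounds `h1 … h6` (as in `knThm2_arith`), strictly positive
`P₁₂, P₁, P₂`, and the certificate `hR` give `0 ≤ I + II + III + D`.  [cite: KozmaNitzan2024, Theorem 2, proof (p. 9)] -/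
theorem knThm2_region_arith {T₁₂ U₁₂ T₁ U₁ T₂ U₂ P₁₂ P₁ P₂ A₁₂ A₁ A₂ m₁₂ m₃ m₁ m₂₃ m₂ m₁₃ D : ℝ}
    (hP₁₂ : 0 < P₁₂) (hP₁ : 0 < P₁) (hP₂ : 0 < P₂)
    (h1 : A₁₂ * m₁₂ ≤ P₁₂ * T₁₂) (h2 : P₁₂ * U₁₂ ≤ A₁₂ * m₃)
    (h3 : A₁ * m₁ ≤ P₁ * T₁) (h4 : P₁ * U₁ ≤ A₁ * m₂₃)
    (h5 : A₂ * m₂ ≤ P₂ * T₂) (h6 : P₂ * U₂ ≤ A₂ * m₁₃)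
    (hR : 0 ≤ A₁₂ * P₁ * P₂ * (m₁₂ - m₃) + A₁ * P₁₂ * P₂ * (m₁ - m₂₃) + A₂ * P₁₂ * P₁ * (m₂ - m₁₃)
            + P₁ * P₂ * P₁₂ * D) :
    0 ≤ (T₁₂ - U₁₂) + (T₁ - U₁) + (T₂ - U₂) + D := by
  have ha : A₁₂ * (m₁₂ - m₃) ≤ P₁₂ * (T₁₂ - U₁₂) := by linarith
  have hb : A₁ * (m₁ - m₂₃) ≤ P₁ * (T₁ - U₁) := by linarith
  have hc : A₂ * (m₂ - m₁₃) ≤ P₂ * (T₂ - U₂) := by linarith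
  have ha' := mul_le_mul_of_nonneg_left ha (mul_nonneg hP₁.le hP₂.le)
  have hb' := mul_le_mul_of_nonneg_left hb (mul_nonneg hP₁₂.le hP₂.le)
  have hc' := mul_le_mul_of_nonneg_left hc (mul_nonneg hP₁₂.le hP₁.le)
  have hpos : 0 < P₁ * P₂ * P₁₂ := mul_pos (mul_pos hP₁ hP₂) hP₁₂
  by_contra hneg
  push Not at hneg
  have hlt : P₁ * P₂ * P₁₂ * ((T₁₂ - U₁₂) + (T₁ - U₁) + (T₂ - U₂) + D) < 0 := mul_neg_of_pos_of_neg hpos hneg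
  nlinarith [ha', hb', hc', hR, hlt]

/-- **The bad region of three relays, core inequality**: with the set-BHK inequalities `hB1, hB2` (= the two halves
of the landed `stub_bhkSets`), `μ(N₁₂), μ(N₁), μ(N₂) > 0` and the certificate (T1) `hR`, one gets
`μ(o↔A, a₃↔b) ≤ μ(o↔A, o↔b) + μ(o↮A, a₃↮b)`.  Proof: KN's six BHK bounds (`knThm2_bhkOne/Two`), the partitions
`knThm2_partA/B`, and `knThm2_region_arith`. [cite: KozmaNitzan2024, Theorem 2 (§3.2, pp. 8–9)] -/
theorem knThm2_region_core
    (hB1 : ∀ (n : ℕ) (w : Sym2 (Fin n) → unitInterval) (S : Finset (Fin n)) (X : Set (Fin n))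
        (F G : Set (Sym2 (Fin n)) → ℝ), Monotone F → Monotone G → (∀ s ∈ S, s ∉ X) →
        (∫ ω in {ω : BondConfig (Fin n) | ∀ s ∈ S, ∀ x ∈ X, ¬ (openGraph ω).Reachable s x},
            F (⋃ s ∈ S, openEdgeCluster ω s) ∂(prodBernoulli w)) *
          (∫ ω in {ω : BondConfig (Fin n) | ∀ s ∈ S, ∀ x ∈ X, ¬ (openGraph ω).Reachable s x},
            G (⋃ s ∈ S, openEdgeCluster ω s) ∂(prodBernoulli w)) ≤
        (prodBernoulli w).real
            {ω : BondConfig (Fin n) | ∀ s ∈ S, ∀ x ∈ X, ¬ (openGraph ω).Reachable s x} *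
          ∫ ω in {ω : BondConfig (Fin n) | ∀ s ∈ S, ∀ x ∈ X, ¬ (openGraph ω).Reachable s x},
            F (⋃ s ∈ S, openEdgeCluster ω s) * G (⋃ s ∈ S, openEdgeCluster ω s)
              ∂(prodBernoulli w))
    (hB2 : ∀ (n : ℕ) (w : Sym2 (Fin n) → unitInterval) (S S' : Finset (Fin n))
        (F G : Set (Sym2 (Fin n)) → ℝ), Monotone F → Monotone G → Disjoint S S' →
        (prodBernoulli w).real
            {ω : BondConfig (Fin n) | ∀ s ∈ S, ∀ x ∈ S', ¬ (openGraph ω).Reachable s x} *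
          (∫ ω in {ω : BondConfig (Fin n) | ∀ s ∈ S, ∀ x ∈ S', ¬ (openGraph ω).Reachable s x},
            F (⋃ s ∈ S, openEdgeCluster ω s) * G (⋃ s ∈ S', openEdgeCluster ω s)
              ∂(prodBernoulli w)) ≤
        (∫ ω in {ω : BondConfig (Fin n) | ∀ s ∈ S, ∀ x ∈ S', ¬ (openGraph ω).Reachable s x},
            F (⋃ s ∈ S, openEdgeCluster ω s) ∂(prodBernoulli w)) *
          (∫ ω in {ω : BondConfig (Fin n) | ∀ s ∈ S, ∀ x ∈ S', ¬ (openGraph ω).Reachable s x},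
            G (⋃ s ∈ S', openEdgeCluster ω s) ∂(prodBernoulli w)))
    (w : Sym2 (Fin n) → unitInterval) (o b a₁ a₂ a₃ : Fin n)
    (h12 : a₁ ≠ a₂) (h13 : a₁ ≠ a₃) (h23 : a₂ ≠ a₃)
    (hP₁₂ : 0 < (prodBernoulli w).real ((openConn a₁ a₃)ᶜ ∩ (openConn a₂ a₃)ᶜ : Set (BondConfig (Fin n))))
    (hP₁ : 0 < (prodBernoulli w).real ((openConn a₁ a₂)ᶜ ∩ (openConn a₁ a₃)ᶜ : Set (BondConfig (Fin n))))
    (hP₂ : 0 < (prodBernoulli w).real ((openConn a₂ a₁)ᶜ ∩ (openConn a₂ a₃)ᶜ : Set (BondConfig (Fin n))))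
    (hR : 0 ≤
      (prodBernoulli w).real ((openConn a₁ a₃)ᶜ ∩ (openConn a₂ a₃)ᶜ ∩ (openConn a₁ o ∪ openConn a₂ o)) *
            (prodBernoulli w).real ((openConn a₁ a₂)ᶜ ∩ (openConn a₁ a₃)ᶜ : Set (BondConfig (Fin n))) *
            (prodBernoulli w).real ((openConn a₂ a₁)ᶜ ∩ (openConn a₂ a₃)ᶜ : Set (BondConfig (Fin n))) *
          ((prodBernoulli w).real ((openConn a₁ a₃)ᶜ ∩ (openConn a₂ a₃)ᶜ ∩ (openConn a₁ b ∩ openConn a₂ b)) -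
            (prodBernoulli w).real ((openConn a₁ a₃)ᶜ ∩ (openConn a₂ a₃)ᶜ ∩ openConn a₃ b)) +
        (prodBernoulli w).real ((openConn a₁ a₂)ᶜ ∩ (openConn a₁ a₃)ᶜ ∩ openConn a₁ o) *
            (prodBernoulli w).real ((openConn a₁ a₃)ᶜ ∩ (openConn a₂ a₃)ᶜ : Set (BondConfig (Fin n))) *
            (prodBernoulli w).real ((openConn a₂ a₁)ᶜ ∩ (openConn a₂ a₃)ᶜ : Set (BondConfig (Fin n))) *
          ((prodBernoulli w).real ((openConn a₁ a₂)ᶜ ∩ (openConn a₁ a₃)ᶜ ∩ openConn a₁ b) -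
            (prodBernoulli w).real ((openConn a₁ a₂)ᶜ ∩ (openConn a₁ a₃)ᶜ ∩ (openConn a₂ b ∩ openConn a₃ b))) +
        (prodBernoulli w).real ((openConn a₂ a₁)ᶜ ∩ (openConn a₂ a₃)ᶜ ∩ openConn a₂ o) *
            (prodBernoulli w).real ((openConn a₁ a₃)ᶜ ∩ (openConn a₂ a₃)ᶜ : Set (BondConfig (Fin n))) *
            (prodBernoulli w).real ((openConn a₁ a₂)ᶜ ∩ (openConn a₁ a₃)ᶜ : Set (BondConfig (Fin n))) *
          ((prodBernoulli w).real ((openConn a₂ a₁)ᶜ ∩ (openConn a₂ a₃)ᶜ ∩ openConn a₂ b) -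
            (prodBernoulli w).real ((openConn a₂ a₁)ᶜ ∩ (openConn a₂ a₃)ᶜ ∩ (openConn a₁ b ∩ openConn a₃ b))) +
        (prodBernoulli w).real ((openConn a₁ a₂)ᶜ ∩ (openConn a₁ a₃)ᶜ : Set (BondConfig (Fin n))) *
            (prodBernoulli w).real ((openConn a₂ a₁)ᶜ ∩ (openConn a₂ a₃)ᶜ : Set (BondConfig (Fin n))) *
            (prodBernoulli w).real ((openConn a₁ a₃)ᶜ ∩ (openConn a₂ a₃)ᶜ : Set (BondConfig (Fin n))) *
          (prodBernoulli w).real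
            ((openConn o a₁ ∪ openConn o a₂ ∪ openConn o a₃)ᶜ ∩ (openConn a₃ b)ᶜ : Set (BondConfig (Fin n)))) :
    (prodBernoulli w).real ((openConn o a₁ ∪ openConn o a₂ ∪ openConn o a₃) ∩ openConn a₃ b) ≤
      (prodBernoulli w).real ((openConn o a₁ ∪ openConn o a₂ ∪ openConn o a₃) ∩ openConn o b) +
        (prodBernoulli w).real
          ((openConn o a₁ ∪ openConn o a₂ ∪ openConn o a₃)ᶜ ∩ (openConn a₃ b)ᶜ : Set (BondConfig (Fin n))) := by
  -- the six set-BHK bounds (KN p. 9), exactly as in `knThm2_core`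
  have i1 := knThm2_bhkOne hB1 w {a₁, a₂} ({a₃} : Set (Fin n)) o b (by simp [h13, h23])
  have i2 := knThm2_bhkTwo hB2 w {a₁, a₂} {a₃} o b (by simp [h13.symm, h23.symm])
  have i3 := knThm2_bhkOne hB1 w {a₁} ({a₂, a₃} : Set (Fin n)) o b (by simp [h12, h13])
  have i4 := knThm2_bhkTwo hB2 w {a₁} {a₂, a₃} o b (by simp [h12, h13])
  have i5 := knThm2_bhkOne hB1 w {a₂} ({a₁, a₃} : Set (Fin n)) o b (by simp [h12.symm, h23])
  have i6 := knThm2_bhkTwo hB2 w {a₂} {a₁, a₃} o b (by simp [h12.symm, h23])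
  rw [knThm2_sep_pair_set, Finset.set_biUnion_insert, Finset.set_biUnion_singleton,
    Finset.set_biInter_insert, Finset.set_biInter_singleton] at i1
  rw [knThm2_sep_pair_finset, Finset.set_biUnion_insert, Finset.set_biUnion_singleton,
    Finset.set_biInter_singleton] at i2
  rw [knThm2_sep_single_set, Finset.set_biUnion_singleton, Finset.set_biInter_singleton] at i3
  rw [knThm2_sep_single_finset, Finset.set_biUnion_singleton, Finset.set_biInter_insert,
    Finset.set_biInter_singleton] at i4
  rw [knThm2_sep_single_set, Finset.set_biUnion_singleton, Finset.set_biInter_singleton] at i5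
  rw [knThm2_sep_single_finset, Finset.set_biUnion_singleton, Finset.set_biInter_insert,
    Finset.set_biInter_singleton] at i6
  -- `X = I + II + III`
  have hA := knThm2_partA w o b a₁ a₂ a₃
  have hB := knThm2_partB w o b a₁ a₂ a₃
  have key := knThm2_region_arith hP₁₂ hP₁ hP₂ i1 i2 i3 i4 i5 i6 hR
  linarith

/-- **Positivity of the separation events in the bad region.**  If `m₁₂ < m₃` and `a₃` is a worst relay, then
`μ(N₁₂), μ(N₁), μ(N₂) > 0` (`N₁₂ ⊇ {C(b) ∩ A = {a₃}}`, and `τ₁ − τ₃ = (m₁ + m₁₂) − (m₃ + m₂₃)` forces `m₁ > m₂₃ ≥ 0`,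
`N₁ ⊇ {C(b) ∩ A = {a₁}}`; similarly for `N₂`). [cite: KozmaNitzan2024, Theorem 2, proof (p. 8, eq. (7))] -/
theorem knThm2_region_pos (w : Sym2 (Fin n) → unitInterval) (b a₁ a₂ a₃ : Fin n)
    (hτ31 : (prodBernoulli w).real (openConn a₃ b) ≤ (prodBernoulli w).real (openConn a₁ b))
    (hτ32 : (prodBernoulli w).real (openConn a₃ b) ≤ (prodBernoulli w).real (openConn a₂ b))
    (hbad : (prodBernoulli w).real ((openConn a₁ a₃)ᶜ ∩ (openConn a₂ a₃)ᶜ ∩ (openConn a₁ b ∩ openConn a₂ b)) <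
      (prodBernoulli w).real ((openConn a₁ a₃)ᶜ ∩ (openConn a₂ a₃)ᶜ ∩ openConn a₃ b)) :
    0 < (prodBernoulli w).real ((openConn a₁ a₃)ᶜ ∩ (openConn a₂ a₃)ᶜ : Set (BondConfig (Fin n))) ∧
    0 < (prodBernoulli w).real ((openConn a₁ a₂)ᶜ ∩ (openConn a₁ a₃)ᶜ : Set (BondConfig (Fin n))) ∧
    0 < (prodBernoulli w).real ((openConn a₂ a₁)ᶜ ∩ (openConn a₂ a₃)ᶜ : Set (BondConfig (Fin n))) := by
  have hτ1 := knThm2_tau_sub w b a₁ a₂ a₃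
  have hτ2 := knThm2_tau_sub w b a₂ a₁ a₃
  rw [Set.inter_comm (openConn a₂ a₃)ᶜ (openConn a₁ a₃)ᶜ,
    Set.inter_comm (openConn a₂ b) (openConn a₁ b)] at hτ2
  have hm12 : 0 ≤ (prodBernoulli w).real
      ((openConn a₁ a₃)ᶜ ∩ (openConn a₂ a₃)ᶜ ∩ (openConn a₁ b ∩ openConn a₂ b)) := measureReal_nonneg
  have hm23 : 0 ≤ (prodBernoulli w).real
      ((openConn a₁ a₂)ᶜ ∩ (openConn a₁ a₃)ᶜ ∩ (openConn a₂ b ∩ openConn a₃ b)) := measureReal_nonneg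
  have hm13 : 0 ≤ (prodBernoulli w).real
      ((openConn a₂ a₁)ᶜ ∩ (openConn a₂ a₃)ᶜ ∩ (openConn a₁ b ∩ openConn a₃ b)) := measureReal_nonneg
  have l12 : (prodBernoulli w).real ((openConn a₁ a₃)ᶜ ∩ (openConn a₂ a₃)ᶜ ∩ openConn a₃ b) ≤
      (prodBernoulli w).real ((openConn a₁ a₃)ᶜ ∩ (openConn a₂ a₃)ᶜ : Set (BondConfig (Fin n))) :=
    measureReal_mono Set.inter_subset_left
  have l1 : (prodBernoulli w).real ((openConn a₁ a₂)ᶜ ∩ (openConn a₁ a₃)ᶜ ∩ openConn a₁ b) ≤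
      (prodBernoulli w).real ((openConn a₁ a₂)ᶜ ∩ (openConn a₁ a₃)ᶜ : Set (BondConfig (Fin n))) :=
    measureReal_mono Set.inter_subset_left
  have l2 : (prodBernoulli w).real ((openConn a₂ a₁)ᶜ ∩ (openConn a₂ a₃)ᶜ ∩ openConn a₂ b) ≤
      (prodBernoulli w).real ((openConn a₂ a₁)ᶜ ∩ (openConn a₂ a₃)ᶜ : Set (BondConfig (Fin n))) :=
    measureReal_mono Set.inter_subset_left
  refine ⟨by linarith, by linarith, by linarith⟩

/-- **The bad region, additive E-form**: under the hypotheses of `knThm2_region_core` with `a₃` worst and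
`m₁₂ < m₃`, `μ({o ↔ A} ∖ {o ↔ b}) ≤ μ(a₃ ↮ b)`. [cite: KozmaNitzan2024, Theorem 2 (§3.2, pp. 8–9)] -/
theorem knThm2_region_eform
    (hB1 : ∀ (n : ℕ) (w : Sym2 (Fin n) → unitInterval) (S : Finset (Fin n)) (X : Set (Fin n))
        (F G : Set (Sym2 (Fin n)) → ℝ), Monotone F → Monotone G → (∀ s ∈ S, s ∉ X) →
        (∫ ω in {ω : BondConfig (Fin n) | ∀ s ∈ S, ∀ x ∈ X, ¬ (openGraph ω).Reachable s x},
            F (⋃ s ∈ S, openEdgeCluster ω s) ∂(prodBernoulli w)) *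
          (∫ ω in {ω : BondConfig (Fin n) | ∀ s ∈ S, ∀ x ∈ X, ¬ (openGraph ω).Reachable s x},
            G (⋃ s ∈ S, openEdgeCluster ω s) ∂(prodBernoulli w)) ≤
        (prodBernoulli w).real
            {ω : BondConfig (Fin n) | ∀ s ∈ S, ∀ x ∈ X, ¬ (openGraph ω).Reachable s x} *
          ∫ ω in {ω : BondConfig (Fin n) | ∀ s ∈ S, ∀ x ∈ X, ¬ (openGraph ω).Reachable s x},
            F (⋃ s ∈ S, openEdgeCluster ω s) * G (⋃ s ∈ S, openEdgeCluster ω s)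
              ∂(prodBernoulli w))
    (hB2 : ∀ (n : ℕ) (w : Sym2 (Fin n) → unitInterval) (S S' : Finset (Fin n))
        (F G : Set (Sym2 (Fin n)) → ℝ), Monotone F → Monotone G → Disjoint S S' →
        (prodBernoulli w).real
            {ω : BondConfig (Fin n) | ∀ s ∈ S, ∀ x ∈ S', ¬ (openGraph ω).Reachable s x} *
          (∫ ω in {ω : BondConfig (Fin n) | ∀ s ∈ S, ∀ x ∈ S', ¬ (openGraph ω).Reachable s x},
            F (⋃ s ∈ S, openEdgeCluster ω s) * G (⋃ s ∈ S', openEdgeCluster ω s)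
              ∂(prodBernoulli w)) ≤
        (∫ ω in {ω : BondConfig (Fin n) | ∀ s ∈ S, ∀ x ∈ S', ¬ (openGraph ω).Reachable s x},
            F (⋃ s ∈ S, openEdgeCluster ω s) ∂(prodBernoulli w)) *
          (∫ ω in {ω : BondConfig (Fin n) | ∀ s ∈ S, ∀ x ∈ S', ¬ (openGraph ω).Reachable s x},
            G (⋃ s ∈ S', openEdgeCluster ω s) ∂(prodBernoulli w)))
    (w : Sym2 (Fin n) → unitInterval) (o b a₁ a₂ a₃ : Fin n)
    (h12 : a₁ ≠ a₂) (h13 : a₁ ≠ a₃) (h23 : a₂ ≠ a₃)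
    (hτ31 : (prodBernoulli w).real (openConn a₃ b) ≤ (prodBernoulli w).real (openConn a₁ b))
    (hτ32 : (prodBernoulli w).real (openConn a₃ b) ≤ (prodBernoulli w).real (openConn a₂ b))
    (hbad : (prodBernoulli w).real ((openConn a₁ a₃)ᶜ ∩ (openConn a₂ a₃)ᶜ ∩ (openConn a₁ b ∩ openConn a₂ b)) <
      (prodBernoulli w).real ((openConn a₁ a₃)ᶜ ∩ (openConn a₂ a₃)ᶜ ∩ openConn a₃ b))
    (hR : 0 ≤
      (prodBernoulli w).real ((openConn a₁ a₃)ᶜ ∩ (openConn a₂ a₃)ᶜ ∩ (openConn a₁ o ∪ openConn a₂ o)) *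
            (prodBernoulli w).real ((openConn a₁ a₂)ᶜ ∩ (openConn a₁ a₃)ᶜ : Set (BondConfig (Fin n))) *
            (prodBernoulli w).real ((openConn a₂ a₁)ᶜ ∩ (openConn a₂ a₃)ᶜ : Set (BondConfig (Fin n))) *
          ((prodBernoulli w).real ((openConn a₁ a₃)ᶜ ∩ (openConn a₂ a₃)ᶜ ∩ (openConn a₁ b ∩ openConn a₂ b)) -
            (prodBernoulli w).real ((openConn a₁ a₃)ᶜ ∩ (openConn a₂ a₃)ᶜ ∩ openConn a₃ b)) +
        (prodBernoulli w).real ((openConn a₁ a₂)ᶜ ∩ (openConn a₁ a₃)ᶜ ∩ openConn a₁ o) *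
            (prodBernoulli w).real ((openConn a₁ a₃)ᶜ ∩ (openConn a₂ a₃)ᶜ : Set (BondConfig (Fin n))) *
            (prodBernoulli w).real ((openConn a₂ a₁)ᶜ ∩ (openConn a₂ a₃)ᶜ : Set (BondConfig (Fin n))) *
          ((prodBernoulli w).real ((openConn a₁ a₂)ᶜ ∩ (openConn a₁ a₃)ᶜ ∩ openConn a₁ b) -
            (prodBernoulli w).real ((openConn a₁ a₂)ᶜ ∩ (openConn a₁ a₃)ᶜ ∩ (openConn a₂ b ∩ openConn a₃ b))) +
        (prodBernoulli w).real ((openConn a₂ a₁)ᶜ ∩ (openConn a₂ a₃)ᶜ ∩ openConn a₂ o) *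
            (prodBernoulli w).real ((openConn a₁ a₃)ᶜ ∩ (openConn a₂ a₃)ᶜ : Set (BondConfig (Fin n))) *
            (prodBernoulli w).real ((openConn a₁ a₂)ᶜ ∩ (openConn a₁ a₃)ᶜ : Set (BondConfig (Fin n))) *
          ((prodBernoulli w).real ((openConn a₂ a₁)ᶜ ∩ (openConn a₂ a₃)ᶜ ∩ openConn a₂ b) -
            (prodBernoulli w).real ((openConn a₂ a₁)ᶜ ∩ (openConn a₂ a₃)ᶜ ∩ (openConn a₁ b ∩ openConn a₃ b))) +
        (prodBernoulli w).real ((openConn a₁ a₂)ᶜ ∩ (openConn a₁ a₃)ᶜ : Set (BondConfig (Fin n))) *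
            (prodBernoulli w).real ((openConn a₂ a₁)ᶜ ∩ (openConn a₂ a₃)ᶜ : Set (BondConfig (Fin n))) *
            (prodBernoulli w).real ((openConn a₁ a₃)ᶜ ∩ (openConn a₂ a₃)ᶜ : Set (BondConfig (Fin n))) *
          (prodBernoulli w).real
            ((openConn o a₁ ∪ openConn o a₂ ∪ openConn o a₃)ᶜ ∩ (openConn a₃ b)ᶜ : Set (BondConfig (Fin n)))) :
    (prodBernoulli w).real ((openConn o a₁ ∪ openConn o a₂ ∪ openConn o a₃) \ openConn o b) ≤
      (prodBernoulli w).real ((openConn a₃ b)ᶜ : Set (BondConfig (Fin n))) := by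
  obtain ⟨hP₁₂, hP₁, hP₂⟩ := knThm2_region_pos w b a₁ a₂ a₃ hτ31 hτ32 hbad
  have hX := knThm2_region_core hB1 hB2 w o b a₁ a₂ a₃ h12 h13 h23 hP₁₂ hP₁ hP₂ hR
  have hm : ∀ s : Set (BondConfig (Fin n)), MeasurableSet s := fun _ => MeasurableSet.of_discrete
  have h1 := measureReal_inter_add_sdiff (μ := prodBernoulli w)
    (s := openConn o a₁ ∪ openConn o a₂ ∪ openConn o a₃) (hm (openConn o b))
  have h2 := measureReal_inter_add_sdiff (μ := prodBernoulli w)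
    (s := openConn o a₁ ∪ openConn o a₂ ∪ openConn o a₃) (hm (openConn a₃ b))
  have h3 := measureReal_inter_add_sdiff (μ := prodBernoulli w)
    (s := ((openConn a₃ b)ᶜ : Set (BondConfig (Fin n)))) (hm (openConn o a₁ ∪ openConn o a₂ ∪ openConn o a₃))
  have e1 : ((openConn a₃ b)ᶜ : Set (BondConfig (Fin n))) ∩ (openConn o a₁ ∪ openConn o a₂ ∪ openConn o a₃) =
      (openConn o a₁ ∪ openConn o a₂ ∪ openConn o a₃) \ openConn a₃ b := by
    ext ω; simp only [Set.mem_inter_iff, Set.mem_compl_iff, Set.mem_sdiff]; tauto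
  have e2 : ((openConn a₃ b)ᶜ : Set (BondConfig (Fin n))) \ (openConn o a₁ ∪ openConn o a₂ ∪ openConn o a₃) =
      (openConn o a₁ ∪ openConn o a₂ ∪ openConn o a₃)ᶜ ∩ (openConn a₃ b)ᶜ := by
    ext ω; simp only [Set.mem_inter_iff, Set.mem_compl_iff, Set.mem_sdiff]; tauto
  rw [e1, e2] at h3
  linarith

/-- **Additive gluing for three relays, reduced to the bad-region certificate (T1).**  If (T1) holds whenever
`a₃` is a worst relay, `o` is strictly less reliable than `a₃` and `m₁₂ < m₃`, then for all three distinct relays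
`a₁, a₂, a₃ ≠ b` with `μ(aᵢ ↔ b) ≥ 1 − t` and `a₃` worst:  `μ({o ↔ A} ∖ {o ↔ b}) ≤ t`.
Cases: `τ(o) ≥ τ₃` (then `μ(o↔A ∖ o↔b) ≤ μ(o↮b) ≤ μ(a₃↮b)`); `m₃ ≤ m₁₂` = Kozma–Nitzan's Theorem 2
(`knThm2_core` with the landed `stub_bhkSets`, `stub_knLemma2`); `m₁₂ < m₃` = `knThm2_region_eform`.
[cite: KozmaNitzan2024, Theorem 2 (§3.2, pp. 8–9)] -/
theorem additiveGluing_threeRelays_of_regionCert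
    (hcert : ∀ (n : ℕ) (w : Sym2 (Fin n) → unitInterval) (o b a₁ a₂ a₃ : Fin n),
      a₁ ≠ a₂ → a₁ ≠ a₃ → a₂ ≠ a₃ →
      (prodBernoulli w).real (openConn a₃ b) ≤ (prodBernoulli w).real (openConn a₁ b) →
      (prodBernoulli w).real (openConn a₃ b) ≤ (prodBernoulli w).real (openConn a₂ b) →
      (prodBernoulli w).real (openConn o b) < (prodBernoulli w).real (openConn a₃ b) →
      (prodBernoulli w).real ((openConn a₁ a₃)ᶜ ∩ (openConn a₂ a₃)ᶜ ∩ (openConn a₁ b ∩ openConn a₂ b)) <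
        (prodBernoulli w).real ((openConn a₁ a₃)ᶜ ∩ (openConn a₂ a₃)ᶜ ∩ openConn a₃ b) →
      0 ≤
      (prodBernoulli w).real ((openConn a₁ a₃)ᶜ ∩ (openConn a₂ a₃)ᶜ ∩ (openConn a₁ o ∪ openConn a₂ o)) *
            (prodBernoulli w).real ((openConn a₁ a₂)ᶜ ∩ (openConn a₁ a₃)ᶜ : Set (BondConfig (Fin n))) *
            (prodBernoulli w).real ((openConn a₂ a₁)ᶜ ∩ (openConn a₂ a₃)ᶜ : Set (BondConfig (Fin n))) *
          ((prodBernoulli w).real ((openConn a₁ a₃)ᶜ ∩ (openConn a₂ a₃)ᶜ ∩ (openConn a₁ b ∩ openConn a₂ b)) -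
            (prodBernoulli w).real ((openConn a₁ a₃)ᶜ ∩ (openConn a₂ a₃)ᶜ ∩ openConn a₃ b)) +
        (prodBernoulli w).real ((openConn a₁ a₂)ᶜ ∩ (openConn a₁ a₃)ᶜ ∩ openConn a₁ o) *
            (prodBernoulli w).real ((openConn a₁ a₃)ᶜ ∩ (openConn a₂ a₃)ᶜ : Set (BondConfig (Fin n))) *
            (prodBernoulli w).real ((openConn a₂ a₁)ᶜ ∩ (openConn a₂ a₃)ᶜ : Set (BondConfig (Fin n))) *
          ((prodBernoulli w).real ((openConn a₁ a₂)ᶜ ∩ (openConn a₁ a₃)ᶜ ∩ openConn a₁ b) -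
            (prodBernoulli w).real ((openConn a₁ a₂)ᶜ ∩ (openConn a₁ a₃)ᶜ ∩ (openConn a₂ b ∩ openConn a₃ b))) +
        (prodBernoulli w).real ((openConn a₂ a₁)ᶜ ∩ (openConn a₂ a₃)ᶜ ∩ openConn a₂ o) *
            (prodBernoulli w).real ((openConn a₁ a₃)ᶜ ∩ (openConn a₂ a₃)ᶜ : Set (BondConfig (Fin n))) *
            (prodBernoulli w).real ((openConn a₁ a₂)ᶜ ∩ (openConn a₁ a₃)ᶜ : Set (BondConfig (Fin n))) *
          ((prodBernoulli w).real ((openConn a₂ a₁)ᶜ ∩ (openConn a₂ a₃)ᶜ ∩ openConn a₂ b) -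
            (prodBernoulli w).real ((openConn a₂ a₁)ᶜ ∩ (openConn a₂ a₃)ᶜ ∩ (openConn a₁ b ∩ openConn a₃ b))) +
        (prodBernoulli w).real ((openConn a₁ a₂)ᶜ ∩ (openConn a₁ a₃)ᶜ : Set (BondConfig (Fin n))) *
            (prodBernoulli w).real ((openConn a₂ a₁)ᶜ ∩ (openConn a₂ a₃)ᶜ : Set (BondConfig (Fin n))) *
            (prodBernoulli w).real ((openConn a₁ a₃)ᶜ ∩ (openConn a₂ a₃)ᶜ : Set (BondConfig (Fin n))) *
          (prodBernoulli w).real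
            ((openConn o a₁ ∪ openConn o a₂ ∪ openConn o a₃)ᶜ ∩ (openConn a₃ b)ᶜ : Set (BondConfig (Fin n)))) :
    ∀ (n : ℕ) (w : Sym2 (Fin n) → unitInterval) (o b a₁ a₂ a₃ : Fin n) (t : ℝ),
      a₁ ≠ a₂ → a₁ ≠ a₃ → a₂ ≠ a₃ →
      1 - t ≤ (prodBernoulli w).real (openConn a₃ b) →
      (prodBernoulli w).real (openConn a₃ b) ≤ (prodBernoulli w).real (openConn a₁ b) →
      (prodBernoulli w).real (openConn a₃ b) ≤ (prodBernoulli w).real (openConn a₂ b) →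
      (prodBernoulli w).real ((openConn o a₁ ∪ openConn o a₂ ∪ openConn o a₃) \ openConn o b) ≤ t := by
  intro n w o b a₁ a₂ a₃ t h12 h13 h23 hτ3 hτ31 hτ32
  have hm : ∀ s : Set (BondConfig (Fin n)), MeasurableSet s := fun _ => MeasurableSet.of_discrete
  -- `μ(a₃ ↮ b) = 1 − τ₃ ≤ t`
  have hc3 : (prodBernoulli w).real ((openConn a₃ b)ᶜ : Set (BondConfig (Fin n))) =
      1 - (prodBernoulli w).real (openConn a₃ b : Set (BondConfig (Fin n))) := probReal_compl_eq_one_sub (hm _)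
  suffices hE : (prodBernoulli w).real ((openConn o a₁ ∪ openConn o a₂ ∪ openConn o a₃) \ openConn o b) ≤
      (prodBernoulli w).real ((openConn a₃ b)ᶜ : Set (BondConfig (Fin n))) by linarith
  by_cases hob : (prodBernoulli w).real (openConn a₃ b) ≤ (prodBernoulli w).real (openConn o b)
  · -- `o` at least as reliable as `a₃`: `μ(o↔A ∖ o↔b) ≤ μ(o↮b) = 1 − τ(o) ≤ 1 − τ₃`
    have hco : (prodBernoulli w).real ((openConn o b)ᶜ : Set (BondConfig (Fin n))) =
        1 - (prodBernoulli w).real (openConn o b : Set (BondConfig (Fin n))) := probReal_compl_eq_one_sub (hm _)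
    have hsub : (prodBernoulli w).real ((openConn o a₁ ∪ openConn o a₂ ∪ openConn o a₃) \ openConn o b) ≤
        (prodBernoulli w).real ((openConn o b)ᶜ : Set (BondConfig (Fin n))) :=
      measureReal_mono (fun ω hω => hω.2)
    linarith
  · push Not at hob
    by_cases hgood : (prodBernoulli w).real (openConn b a₃ ∩ (openConn b a₁)ᶜ ∩ (openConn b a₂)ᶜ) ≤
        (prodBernoulli w).real (openConn b a₁ ∩ openConn b a₂ ∩ (openConn b a₃)ᶜ)
    · -- the GOOD case: Kozma–Nitzan's Theorem 2
      have hX := knThm2_core stub_bhkSets.1 stub_bhkSets.2 (stub_knLemma2 stub_bhkSets) w o b a₁ a₂ a₃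
        h12 h13 h23 hτ31 hτ32 hgood
      have h1 := measureReal_inter_add_sdiff (μ := prodBernoulli w)
        (s := openConn o a₁ ∪ openConn o a₂ ∪ openConn o a₃) (hm (openConn o b))
      have h2 := measureReal_inter_add_sdiff (μ := prodBernoulli w)
        (s := openConn o a₁ ∪ openConn o a₂ ∪ openConn o a₃) (hm (openConn a₃ b))
      have h3 : (prodBernoulli w).real ((openConn o a₁ ∪ openConn o a₂ ∪ openConn o a₃) \ openConn a₃ b) ≤
          (prodBernoulli w).real ((openConn a₃ b)ᶜ : Set (BondConfig (Fin n))) :=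
        measureReal_mono fun ω hω => hω.2
      linarith
    · -- the BAD region: the certificate (T1)
      push Not at hgood
      rw [knThm2_m3, knThm2_m12] at hgood
      exact knThm2_region_eform stub_bhkSets.1 stub_bhkSets.2 w o b a₁ a₂ a₃ h12 h13 h23 hτ31 hτ32 hgood
        (hcert n w o b a₁ a₂ a₃ h12 h13 h23 hτ31 hτ32 hob hgood)

end

end Summit.CriticalPhenomena.PercolationContinuityZ3.Theorems
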